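import Summits.BirchSwinnertonDyer.Rank1Residual.X2.GreenbergVatsalProPrimeToPCocycle
import Summits.BirchSwinnertonDyer.Rank1Residual.X2.GreenbergVatsalSelmerLink
import Literature.NumberTheory.EllipticCurves.SelmerGroupOverTorsionFinite
import Literature.NumberTheory.EllipticCurves.GeomPointsGaloisModule
import Literature.NumberTheory.GaloisRepresentations.FrobeniusGeneration
import Literature.NumberTheory.GaloisRepresentations.CyclotomicCharacterFrobeniusProofs
import HarnessLib

/-!
# Unramified classes are locally trivial over `K_∞` away from `p`: the EQUALITY half of the link
# `Sel_{p^∞}(E/K_∞) = S_A(K_∞)` at the good places `v ∤ p` (referee R102.2 (b) / R106.8, nit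
# `gvSelmer-SelmerDualData-link`, equality half)

HONEST FRAMING (cell `b2b-bsdres`, run/shared/lean/b2b/bsd-rank1-residual/, verbatim in every
file): the goal of the cell is to DELETE the COMBINATION-SHAPED residual classes of the
Birch–Swinnerton-Dyer formula for ALL analytic-rank `≤ 1` elliptic curves over `ℚ` — "full BSD
formula for every rank `≤ 1` curve in class `C`" assembled STRICTLY from published theorems — so
that the rank-`≤ 1` remainder becomes exactly the CONSTRUCTION-SHAPED classes, which are TYPED
(missing-input `Prop`s), NOT attempted. This is not "finishing BSD". Sub-cell
`b2b-bsdres-eisenstein-p2` (CLASS-OWNERS row "X2"), gen 10: research route; NO CLAIM BEYOND STATED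
CLASSES; nothing here changes a label. THEOREMS ONLY (no `def`, no named fact, nothing asserted).

THE QUESTION. Gen 9 (`GreenbergVatsalSelmerLink`) proved the INCLUSION
`Sel_{p^∞}(E/K_∞) ⊆ S^{Σ₀}_{E[p^∞]}(K_∞)` of the classical Selmer group (whose Pontryagin dual is
the `D.X` of route G's typed input `CongruentLambdaShift`) in Greenberg–Vatsal's non-primitive
Greenberg Selmer group. The referee (R106.8) keeps nit `gvSelmer-SelmerDualData-link` open for the
EQUALITY half, i.e. Greenberg's `Sel_E(ℚ_∞)_p = S_A(ℚ_∞)` (LNM 1716 §2) and GV's remark (p. 17)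
that over `ℚ_∞` the local condition "unramified at `η ∤ p`" is the same as "trivial at `η`",
because "`G_η/I_η` has profinite order prime to `p`". This file PROVES that remark in the kernel,
for every number field `K`, every `ℤ_p`-extension `κ` and every good place `v ∤ p` that is
unramified and not completely split in `K_∞/K` (both automatic for the cyclotomic tower, §2):

* Sibling files `GreenbergVatsalProPrimeToP`, `GreenbergVatsalProPrimeToPCocycle` (pure
  topological group theory, in the style of the tree's `ResKernel` files). For a profinite `Γ`, subgroups `I ≤ G` ("inertia ⊴ decomposition"), an element `φ ∈ G` such that `G`
  is generated by `φ` and `I` modulo every open subgroup (Frobenius), and `κ : Γ → ℤ_p` with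
  `κ(I) = 1 ≠ κ(φ)`: the image of `P = ker κ ∩ G` in each finite quotient `G/((U·I) ∩ G) = ⟨φ̄⟩`
  has order PRIME TO `p` (`exists_coprime_pow_mem_modSubgroup`: `x ≡ φ^j` forces
  `κ(φ)^j ∈ p^B ℤ_p` for all `B`, so `p^e ∣ j`); hence every continuous `1`-cocycle of `P` with
  values in a discrete `p`-primary `Γ`-module `M` (finite `p^k`-torsion, `I` acting trivially)
  that vanishes on `I` is a COBOUNDARY (`exists_eq_smul_sub_of_vanishing_on_inertia`: on
  `P ∩ U₀` the cocycle is a homomorphism killed by a prime-to-`p` exponent and by `p^N`; on the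
  cyclic image it is the coboundary of `-(1/d) Σ_{i<d} g(σ₀^i)`).
* §1 (number fields). With `Γ = Γ_K`, `G = D_v = D_{𝔓₀}`, `I = I_v = I_{𝔓₀}`
  (`decompositionSubgroup_adicCompletionPrime_eq_range`, `inertia_adicCompletionPrime_eq_map_absInertia`),
  `φ` an arithmetic Frobenius at `𝔓₀` (`exists_isArithFrobAt_of_mem_primesAbove_holds`,
  `FrobeniusGeneration.exists_eq_frobenius_pow_mul_of_mem_decompositionSubgroup`) and
  `M = E[p^∞]` (unramified at good `v ∤ p`, Silverman VII.4.1(a), tree `inertia_smul_eq_of_good`):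
  **`unramKer_le_awayKer_of_good`** (`GreenbergVatsalTorsion.unramKer ≤ GreenbergSelmer.awayKer`
  over `K_∞`, the converse of the tree's `awayKer_le_unramKer`), **`awayKer_le_localKerOver`**
  (locally trivial ⇒ the classical Kummer condition `WeierstrassCurve.localKerOver`), and the
  assembled **`conjH1_mem_localKerOver_of_mem_gvSelmerInfty`**: a class of
  `S^{Σ₀}_{E[p^∞]}(K_∞)` satisfies the classical Selmer condition at EVERY place of `K_∞` above
  every good `v ∉ Σ₀ ∪ {v ∣ p}`.
* §2 (cyclotomic tower). `I_v ≤ ker κ` and `D_v ≰ ker κ` for `v ∤ p` from `χ_p(I_v) = 1` and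
  `χ_p(Frob_v) = N(v)` of infinite order (tree `CyclotomicCharacterFrobeniusProofs`); hence
  **`unramKer_le_localKerOver_of_isCyclotomic`** with no hypothesis on `v` beyond "good, `∤ p`".

WHAT THIS GIVES FOR THE LINK. Combined with gen 9: over `K_∞^{cyc}`, `Sel_{p^∞}(E/K_∞)` and
`S^{Σ₀}_{E[p^∞]}(K_∞)` impose THE SAME local condition at every good `v ∉ Σ₀`, `v ∤ p`. What
stays printed: at `v ∣ p`, Greenberg's `Im κ_η = Im λ_η` (LNM 1716 Prop. 2.4, via Coates–Greenberg;
the inclusion `Im κ ⊆` Greenberg's condition is gen 9's `localKerOver_le_greenbergKer`), and the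
bookkeeping at `v ∈ Σ₀` (GV Cor. 2.3, Prop. 2.4: `S^{Σ₀}/S_A ≅ ∏_{ℓ∈Σ₀} 𝓗_ℓ`).

References: Greenberg–Vatsal, Invent. Math. 142 (2000) = arXiv:math/9906215, §2 p. 17 ("`G_η/I_η`
has profinite order prime to `p`. So the last condition is equivalent to `[σ|_{I_η}] = 0`"), p. 19
(6); Greenberg, LNM 1716 (1999), §2 pp. 69–72 (Prop. 2.1, `Sel_E(F_∞)_p` vs `S_A`); Greenberg,
Adv. Stud. Pure Math. 17 (1989), p. 98 (3)–(4); Neukirch, *ANT*, I (9.4)–(9.6), II (9.6);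
Serre, *Abelian ℓ-adic representations*, I-1.2; Washington, *Cyclotomic Fields*, §13.1.
-/

noncomputable section

open scoped Classical Pointwise

universe u

namespace Summit.BirchSwinnertonDyer.Rank1Residual.X2.GreenbergVatsalUnramifiedAway

open Literature.NumberTheory.GaloisRepresentations Literature.NumberTheory.EllipticCurves
  Literature.NumberTheory.EllipticCurves.ResKernel
  Summit.BirchSwinnertonDyer.Rank1Residual.X2.GreenbergVatsalProPrimeToP
  Summit.BirchSwinnertonDyer.Rank1Residual.X2.GreenbergVatsalProPrimeToPCocycle

/-! ## §1. Number fields: unramified classes at a good `v ∤ p` are locally trivial over `K_∞` -/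

section NumberField

open NumberField IsDedekindDomain Field Literature.NumberTheory.EllipticCurves.GreenbergSelmer
  Summit.BirchSwinnertonDyer.Rank1Residual.X2.GreenbergVatsalTorsion
  Summit.BirchSwinnertonDyer.Rank1Residual.X2.GreenbergVatsalTorsionCurve

variable {K : Type u} [Field K] [NumberField K]

/-- `I_{𝔓}` is normalised by `D_{𝔓}` (Mathlib: the inertia subgroup is normal in the stabiliser).
[folklore] -/
theorem conj_mem_inertia_of_mem_decompositionSubgroup {G R : Type*} [Group G] [CommRing R]
    [MulSemiringAction G R] (P : Ideal R) {g i : G} (hg : g ∈ P.decompositionSubgroup G)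
    (hi : i ∈ P.inertia G) : g * i * g⁻¹ ∈ P.inertia G := by
  rw [AddSubgroup.mem_inertia] at hi ⊢
  intro x
  rw [Submodule.mem_toAddSubgroup, ← Ideal.smul_mem_pointwise_smul_iff (a := g⁻¹), smul_sub,
    smul_smul, ← mul_assoc, inv_mul_cancel_left, mul_smul,
    (MulAction.stabilizer G P).inv_mem (Ideal.mem_decompositionSubgroup_iff.mp hg)]
  exact hi (g⁻¹ • x)

/-- A `p`-adic integer divisible by every power of `p` is `0`. [folklore] -/
theorem padicInt_eq_zero_of_forall_pow_dvd {p : ℕ} [Fact p.Prime] {x : ℤ_[p]}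
    (h : ∀ B : ℕ, (p : ℤ_[p]) ^ B ∣ x) : x = 0 := by
  by_contra hx
  have h1 : (p : ℤ_[p]) ^ (x.valuation + 1) ∣ ((1 : ℕ) : ℤ_[p]) * x := by
    rw [Nat.cast_one, one_mul]; exact h _
  have h2 := pow_dvd_of_pow_valuation_add_dvd hx h1
  rw [pow_one] at h2
  exact (Fact.out : p.Prime).ne_one (Nat.dvd_one.mp h2)

variable {p : ℕ} [Fact p.Prime] (κ : ZpExtension K p) (v : HeightOneSpectrum (𝓞 K))

/-- **"`v` does not split completely in `K_∞/K`" gives `κ(Frob_v) ≠ 1`** when `v` is unramified in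
`K_∞/K` (`I_v ≤ ker κ`): otherwise every `d = φⁿ i u ∈ D_v` would have `κ d = κ u ∈ p^B ℤ_p` for
all `B`. [folklore] -/
theorem kappa_frob_ne_one {φ : absoluteGaloisGroup K}
    (hφ : IsArithFrobAt (𝓞 K) φ (adicCompletionPrime K v))
    (hI : inertia v ≤ κ.kerSubgroup) (hD : ¬ decomp v ≤ κ.kerSubgroup) : κ φ ≠ 1 := by
  intro hκφ
  apply hD
  intro d hd
  rw [ZpExtension.mem_kerSubgroup]
  apply Multiplicative.toAdd.injective
  rw [toAdd_one]
  refine padicInt_eq_zero_of_forall_pow_dvd fun B ↦ ?_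
  have hd' : d ∈ (adicCompletionPrime K v).decompositionSubgroup (absoluteGaloisGroup K) := by
    rw [decompositionSubgroup_adicCompletionPrime_eq_range]; exact hd
  obtain ⟨n, i, u, hi, hu, rfl⟩ := exists_eq_frobenius_pow_mul_of_mem_decompositionSubgroup
    (adicCompletionPrime_mem_primesAbove K v) hφ (κ.isOpen_layerSubgroup B) hd'
  have hi' : i ∈ inertia v := by
    have e : inertia v = (adicCompletionPrime K v).inertia (absoluteGaloisGroup K) :=
      (inertia_adicCompletionPrime_eq_map_absInertia K v).symm
    rw [e]; exact hi
  have hκi : κ i = 1 := ZpExtension.mem_kerSubgroup.mp (hI hi')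
  have e : κ (φ ^ n * i * u) = κ u := by
    rw [map_mul, map_mul, map_pow, hκφ, one_pow, one_mul, hκi, one_mul]
  rw [e]
  exact ZpExtension.mem_layerSubgroup.mp hu

variable (W : WeierstrassCurve K) [W.IsElliptic] (p)

/-- **Unramified ⇒ locally trivial over `K_∞` at a good `v ∤ p`** (GV p. 17; Greenberg 1989 (3)
with `I_v` vs `D_v`): for the `ℤ_p`-extension `κ` (`H = ker κ = Gal(K̄/K_∞)`), a finite place `v ∤ p`
of good reduction for `E` which is UNRAMIFIED in `K_∞/K` (`I_v ≤ ker κ`) and does NOT SPLIT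
COMPLETELY (`D_v ≰ ker κ` — automatic for the cyclotomic tower, `kerSubgroup_cyclotomic_*` below),
a class of `H¹(K_∞, E[p^∞])` unramified at the chosen place above `v`
(`GreenbergVatsalTorsion.unramKer`: dies on `H ⊓ I_v`) dies on the whole decomposition group
`H ⊓ D_v` (`GreenbergSelmer.awayKer`): restriction to inertia is injective on
`H¹(K_{∞,η}, E[p^∞])` because `Gal(K_v^{unr}/K_{∞,η})` is pro-prime-to-`p`
(`exists_eq_smul_sub_of_vanishing_on_inertia`). [cite: GreenbergVatsal2000, §2 p. 17] -/
theorem unramKer_le_awayKer_of_good (hv : W.HasGoodReductionAt v)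
    (hpv : ((p : ℕ) : 𝓞 K) ∉ v.asIdeal) (hI : inertia v ≤ κ.kerSubgroup)
    (hD : ¬ decomp v ≤ κ.kerSubgroup) :
    unramKer κ.kerSubgroup (W.geomPrimaryTorsion p) v ≤
      awayKer κ.kerSubgroup (W.geomPrimaryTorsion p) v := by
  intro c hc
  obtain ⟨f, rfl⟩ :=
    oneCocycleClass_surjective (discreteTopRep κ.kerSubgroup (W.geomPrimaryTorsion p)) c
  obtain ⟨m, hm⟩ :=
    (GreenbergVatsalSelmerLink.oneCocycleClass_mem_unramKer_iff κ.kerSubgroup _ v f).1 hc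
  rw [awayKer, AddMonoidHom.mem_ker, resOfLe_oneCocycleClass_eq_zero_iff κ.kerSubgroup]
  -- the dictionary with `𝔓₀ = adicCompletionPrime K v`
  have hDeq : decomp v = (adicCompletionPrime K v).decompositionSubgroup (absoluteGaloisGroup K) :=
    (decompositionSubgroup_adicCompletionPrime_eq_range K v).symm
  have hIeq : inertia v = (adicCompletionPrime K v).inertia (absoluteGaloisGroup K) :=
    (inertia_adicCompletionPrime_eq_map_absInertia K v).symm
  obtain ⟨φ, hφ⟩ :=
    IsDedekindDomain.HeightOneSpectrum.exists_isArithFrobAt_of_mem_primesAbove_holds (K := K)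
      (v := v) (adicCompletionPrime_mem_primesAbove K v)
  haveI := (adicCompletionPrime_isMaximal K v).isPrime
  have hφD : φ ∈ decomp v := by rw [hDeq]; exact hφ.mem_stabilizer
  -- the abstract theorem
  obtain ⟨b, hb⟩ := exists_eq_smul_sub_of_vanishing_on_inertia (Γ := absoluteGaloisGroup K)
    (M := W.geomPrimaryTorsion p) (G := decomp v) (I := inertia v) (φ := φ)
    (κ := κ.toContinuousMonoidHom.toMonoidHom) (P := κ.kerSubgroup ⊓ decomp v)
    (inertia_le_decomp v)
    (fun g hg i hi ↦ by
      rw [hIeq] at hi ⊢; rw [hDeq] at hg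
      exact conj_mem_inertia_of_mem_decompositionSubgroup _ hg hi)
    hφD
    (fun U hU d hd ↦ by
      rw [hDeq] at hd
      obtain ⟨n, i, u, hi, hu, hdec⟩ := exists_eq_frobenius_pow_mul_of_mem_decompositionSubgroup
        (adicCompletionPrime_mem_primesAbove K v) hφ hU hd
      exact ⟨n, i, u, hIeq ▸ hi, hu, hdec⟩)
    (fun i hi ↦ ZpExtension.mem_kerSubgroup.mp (hI hi))
    (kappa_frob_ne_one κ v hφ hI hD)
    (fun B ↦ ⟨κ.layerSubgroup B, κ.isOpen_layerSubgroup B,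
      fun x hx ↦ ZpExtension.mem_layerSubgroup.mp hx⟩)
    (fun {x} ↦ by rw [Subgroup.mem_inf, ZpExtension.mem_kerSubgroup]; rfl)
    (by
      rw [Subgroup.coe_inf, hDeq]
      exact κ.isClosed_kerSubgroup.inter
        (absIntegers.isClosed_decompositionSubgroup_holds (R := 𝓞 K) (adicCompletionPrime K v)))
    (W.continuous_smul_geomPrimaryTorsion p)
    (fun m ↦ by
      obtain ⟨k, hk⟩ := (AddCommGroup.mem_primaryComponent).1 m.2
      refine ⟨k, Subtype.ext ?_⟩
      rw [AddSubmonoidClass.coe_nsmul, ZeroMemClass.coe_zero]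
      exact hk)
    (fun k ↦ by
      haveI := W.finite_torsionBy_geomPrimaryTorsion p k
      have e : {m : W.geomPrimaryTorsion p | p ^ k • m = 0} =
          ((AddSubgroup.torsionBy (W.geomPrimaryTorsion p) (p ^ k : ℕ) :
            AddSubgroup (W.geomPrimaryTorsion p)) : Set (W.geomPrimaryTorsion p)) := by
        ext m
        rw [Set.mem_setOf_eq, SetLike.mem_coe, AddSubgroup.torsionBy.nsmul_iff]
      rw [e]
      exact Set.toFinite _)
    (fun i hi m ↦ inertia_smul_eq_of_good W p hv hpv hi m)
    (contOneCocycles.pullback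
      (subgroupInclusion (inf_le_left : κ.kerSubgroup ⊓ decomp v ≤ κ.kerSubgroup))
      (resHomOfEquivariant _ (AddMonoidHom.id _) fun _ _ ↦ rfl) f)
    (fun x hxI ↦ by
      rw [contOneCocycles.pullback_apply]
      have hxH : (x : absoluteGaloisGroup K) ∈ κ.kerSubgroup := (Subgroup.mem_inf.1 x.2).1
      have hxD : (x : absoluteGaloisGroup K) ∈ decomp v := (Subgroup.mem_inf.1 x.2).2
      set x' : inertiaIn κ.kerSubgroup v :=
        ⟨⟨x, hxD⟩, (mem_inertiaIn_iff κ.kerSubgroup v _).2 ⟨hxH, hxI⟩⟩ with hx'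
      have h := hm x'
      have e1 : inertiaInToH κ.kerSubgroup v x' =
          subgroupInclusion (inf_le_left : κ.kerSubgroup ⊓ decomp v ≤ κ.kerSubgroup) x :=
        Subtype.ext rfl
      have e2 : x' • m - m = 0 := by
        rw [sub_eq_zero, Subgroup.smul_def, Subgroup.smul_def]
        exact inertia_smul_eq_of_good W p hv hpv hxI m
      rw [e1, e2] at h
      exact h)
  exact ⟨b, fun x ↦ hb x⟩

omit [W.IsElliptic] [Fact p.Prime] in
/-- **Locally trivial on the decomposition group ⇒ the classical local condition**: a class of
`H¹(H, E[p^∞])` dying on `H ⊓ D_v` (`GreenbergSelmer.awayKer`) dies in `H¹(H_{K_v}, E(K̄_v))`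
(`WeierstrassCurve.localKerOver`), since `H_{K_v} → H` factors through `H ⊓ D_v` and
`E[p^∞] → E(K̄_v)` is equivariant. [folklore] -/
theorem awayKer_le_localKerOver (H : Subgroup (absoluteGaloisGroup K)) :
    awayKer H (W.geomPrimaryTorsion p) v ≤ W.localKerOver p H (v.adicCompletion K) := by
  intro c hc
  obtain ⟨f, rfl⟩ := oneCocycleClass_surjective (discreteTopRep H (W.geomPrimaryTorsion p)) c
  rw [awayKer, AddMonoidHom.mem_ker, resOfLe_oneCocycleClass_eq_zero_iff H] at hc
  obtain ⟨a, ha⟩ := hc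
  rw [GreenbergVatsalSelmerLink.oneCocycleClass_mem_localKerOver_iff]
  refine ⟨pointsMap W (v.adicCompletion K) (a : W.geomPoints), fun τ ↦ ?_⟩
  have hτH : resGal (K := K) (v.adicCompletion K) τ ∈ H := (mem_localSubgroup_iff H _ _).1 τ.2
  have hτD : resGal (K := K) (v.adicCompletion K) τ ∈ decomp v := by
    rw [WeierstrassCurve.resGal_eq_absGaloisRestrict]
    exact (mem_decomp_iff v _).2 ⟨(τ : absoluteGaloisGroup (v.adicCompletion K)), rfl⟩
  have hmem : resGal (K := K) (v.adicCompletion K) τ ∈ H ⊓ decomp v :=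
    Subgroup.mem_inf.2 ⟨hτH, hτD⟩
  have key := ha ⟨_, hmem⟩
  have e : subgroupInclusion (inf_le_left : H ⊓ decomp v ≤ H) ⟨_, hmem⟩ =
      resGalSubgroup H (v.adicCompletion K) τ := by
    apply Subtype.ext
    rw [resGalSubgroup_apply_coe, subgroupInclusion_apply_coe]
  rw [e] at key
  rw [key, AddSubgroupClass.coe_sub, map_sub, primaryComponent.coe_smul,
    pointsMap_smul W (v.adicCompletion K) τ (a : W.geomPoints)]


/-- **The two local conditions away from `p` agree over `K_∞` (one direction was
`GreenbergVatsalTorsion.awayKer_le_unramKer`)**: at a good `v ∤ p`, unramified in `K_∞/K` and not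
split completely, an unramified class of `H¹(K_∞, E[p^∞])` satisfies the CLASSICAL (Kummer) local
condition `WeierstrassCurve.localKerOver` at the chosen place above `v` — the class is even locally
trivial, so lies in the image `0 ⊆ Im κ_η` of the local Kummer map (Greenberg LNM 1716 §2, Prop. 2.1:
`Im κ_η = 0` for `η ∤ p`, here only in the direction `S_A ⊆ Sel`). [cite: GreenbergVatsal2000, §2 p. 17]
[cite: GreenbergLNM1716, §2 pp. 69–72] -/
theorem unramKer_le_localKerOver_of_good (hv : W.HasGoodReductionAt v)
    (hpv : ((p : ℕ) : 𝓞 K) ∉ v.asIdeal) (hI : inertia v ≤ κ.kerSubgroup)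
    (hD : ¬ decomp v ≤ κ.kerSubgroup) :
    unramKer κ.kerSubgroup (W.geomPrimaryTorsion p) v ≤
      W.localKerOver p κ.kerSubgroup (v.adicCompletion K) :=
  (unramKer_le_awayKer_of_good (κ := κ) (v := v) (W := W) (p := p) hv hpv hI hD).trans
    (awayKer_le_localKerOver (v := v) (W := W) (p := p) _)

/-- **The "away from `p` and `Σ₀`" half of `S^{Σ₀}_{E[p^∞]}(K_∞) ⊆ Sel_{p^∞}(E/K_∞)`**: a class of
Greenberg–Vatsal's non-primitive Selmer group `gvSelmerInfty κ E[p^∞] L Σ₀` satisfies the classical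
local condition of `WeierstrassCurve.selmerGroupOver` at EVERY place of `K_∞` above every good
`v ∉ Σ₀`, `v ∤ p` which is unramified and not split completely in `K_∞/K` (all `Γ_K`-conjugates,
as in both definitions). With gen 9's `selmerInfty_le_gvSelmerInfty` this settles the comparison of
the two Selmer groups at all such places; what remains is `v ∣ p` (Greenberg's `Im κ = Im λ`,
LNM 1716 Prop. 2.4) and `v ∈ Σ₀`. [cite: GreenbergVatsal2000, §2 pp. 17, 19]
[cite: GreenbergLNM1716, §2 pp. 69–72] -/
theorem conjH1_mem_localKerOver_of_mem_gvSelmerInfty (L : Data K (W.geomPrimaryTorsion p) p)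
    (S₀ : Set (HeightOneSpectrum (𝓞 K))) {c : subgroupH1 κ.kerSubgroup (W.geomPrimaryTorsion p)}
    (hc : c ∈ gvSelmerInfty κ (W.geomPrimaryTorsion p) L S₀) (hvS : v ∉ S₀)
    (hv : W.HasGoodReductionAt v) (hpv : ((p : ℕ) : 𝓞 K) ∉ v.asIdeal)
    (hI : inertia v ≤ κ.kerSubgroup) (hD : ¬ decomp v ≤ κ.kerSubgroup)
    (σ : absoluteGaloisGroup K) :
    conjH1 κ.kerSubgroup (W.geomPrimaryTorsion p) σ c ∈
      W.localKerOver p κ.kerSubgroup (v.adicCompletion K) :=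
  unramKer_le_localKerOver_of_good (κ := κ) (v := v) (W := W) (p := p) hv hpv hI hD
    (((mem_gvSelmer_iff c).1 hc).1 v hvS hpv σ)

end NumberField

/-! ## §2. The cyclotomic `ℤ_p`-extension: every `v ∤ p` is unramified and no `v ∤ p` splits
completely -/

section Cyclotomic

open NumberField IsDedekindDomain Field Literature.NumberTheory.EllipticCurves.GreenbergSelmer
  Summit.BirchSwinnertonDyer.Rank1Residual.X2.GreenbergVatsalTorsion
  Summit.BirchSwinnertonDyer.Rank1Residual.X2.GreenbergVatsalTorsionCurve

variable {K : Type} [Field K] [NumberField K] {p : ℕ} [Fact p.Prime] (κ : ZpExtension K p)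
  (v : HeightOneSpectrum (𝓞 K))

/-- **`v ∤ p` is unramified in the cyclotomic `ℤ_p`-extension**: `I_v ≤ ker κ`, because the
cyclotomic character is trivial on `I_{𝔓₀}` for `v ∤ p` (Serre, *Abelian ℓ-adic representations*,
I-1.2; tree: `GaloisRep.cyclotomicCharacter_eq_one_of_mem_inertia`) and `ker κ = χ_p⁻¹(μ(ℤ_p))`.
[cite: Washington1997, §13.1] [cite: SerreAbelianLadic1968, Ch. I §1.2] -/
theorem inertia_le_kerSubgroup_of_isCyclotomic (hκ : κ.IsCyclotomic)
    (hpv : ((p : ℕ) : 𝓞 K) ∉ v.asIdeal) : inertia v ≤ κ.kerSubgroup := by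
  intro x hx
  have hx' : x ∈ (adicCompletionPrime K v).inertia (absoluteGaloisGroup K) := by
    rw [inertia_adicCompletionPrime_eq_map_absInertia]; exact hx
  have h1 : GaloisRep.cyclotomicCharacter K p x = 1 := by
    rw [GaloisRep.cyclotomicCharacter_apply]
    exact cyclotomicCharacter_eq_one_of_forall_pow_eq_one p _ fun _ _ ht ↦
      smul_eq_self_of_mem_inertia_of_pow_prime_pow_eq_one hpv
        (adicCompletionPrime_mem_primesAbove K v) hx' ht
  rw [hκ, Subgroup.mem_comap]
  change GaloisRep.cyclotomicCharacter K p x ∈ CommGroup.torsion ℤ_[p]ˣ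
  rw [h1]
  exact (CommGroup.torsion ℤ_[p]ˣ).one_mem

/-- **No `v ∤ p` splits completely in the cyclotomic `ℤ_p`-extension**: `D_v ≰ ker κ`, because
`χ_p(Frob_v) = N(v)` has infinite order in `ℤ_pˣ` (tree:
`GaloisRep.cyclotomicCharacter_frob_not_isOfFinOrder`) while `ker κ = χ_p⁻¹(μ(ℤ_p))`.
[cite: Washington1997, §13.1] [cite: SerreAbelianLadic1968, Ch. I §1.2] -/
theorem not_decomp_le_kerSubgroup_of_isCyclotomic (hκ : κ.IsCyclotomic)
    (hpv : ((p : ℕ) : 𝓞 K) ∉ v.asIdeal) : ¬ decomp v ≤ κ.kerSubgroup := by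
  intro hle
  obtain ⟨φ, hφ⟩ :=
    IsDedekindDomain.HeightOneSpectrum.exists_isArithFrobAt_of_mem_primesAbove_holds (K := K)
      (v := v) (adicCompletionPrime_mem_primesAbove K v)
  haveI := (adicCompletionPrime_isMaximal K v).isPrime
  have hφD : φ ∈ decomp v := by
    have hDeq : decomp v = (adicCompletionPrime K v).decompositionSubgroup (absoluteGaloisGroup K) :=
      (decompositionSubgroup_adicCompletionPrime_eq_range K v).symm
    rw [hDeq]; exact hφ.mem_stabilizer
  have h := hle hφD
  rw [hκ, Subgroup.mem_comap] at h
  change GaloisRep.cyclotomicCharacter K p φ ∈ CommGroup.torsion ℤ_[p]ˣ at h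
  rw [CommGroup.mem_torsion] at h
  exact GaloisRep.cyclotomicCharacter_frob_not_isOfFinOrder hpv
    (adicCompletionPrime_mem_primesAbove K v) hφ h

variable (W : WeierstrassCurve K) [W.IsElliptic] (p)

/-- **Over the cyclotomic `ℤ_p`-extension: unramified at a good `v ∤ p` ⇒ the classical local
condition**, all hypotheses on `v` discharged. For `K = ℚ` this is the `ℓ ≠ p` part of Greenberg's
`Sel_E(ℚ_∞)_p = S_A(ℚ_∞)` (LNM 1716 §2) in the direction `S_A ⊆ Sel`, at the good primes.
[cite: GreenbergVatsal2000, §2 p. 17] [cite: GreenbergLNM1716, §2 pp. 69–72] -/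
theorem unramKer_le_localKerOver_of_isCyclotomic (hκ : κ.IsCyclotomic)
    (hv : W.HasGoodReductionAt v) (hpv : ((p : ℕ) : 𝓞 K) ∉ v.asIdeal) :
    unramKer κ.kerSubgroup (W.geomPrimaryTorsion p) v ≤
      W.localKerOver p κ.kerSubgroup (v.adicCompletion K) :=
  unramKer_le_localKerOver_of_good (κ := κ) (v := v) (W := W) (p := p) hv hpv
    (inertia_le_kerSubgroup_of_isCyclotomic κ v hκ hpv)
    (not_decomp_le_kerSubgroup_of_isCyclotomic κ v hκ hpv)

/-- **`S^{Σ₀}_{E[p^∞]}(K_∞^{cyc})` satisfies the classical Selmer conditions at every place above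
every good `v ∉ Σ₀ ∪ {v ∣ p}`** (cyclotomic tower; all conjugates). [cite: GreenbergVatsal2000, §2 pp. 17, 19]
[cite: GreenbergLNM1716, §2 pp. 69–72] -/
theorem conjH1_mem_localKerOver_of_mem_gvSelmerInfty_of_isCyclotomic (hκ : κ.IsCyclotomic)
    (L : Data K (W.geomPrimaryTorsion p) p) (S₀ : Set (HeightOneSpectrum (𝓞 K)))
    {c : subgroupH1 κ.kerSubgroup (W.geomPrimaryTorsion p)}
    (hc : c ∈ gvSelmerInfty κ (W.geomPrimaryTorsion p) L S₀) (hvS : v ∉ S₀)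
    (hv : W.HasGoodReductionAt v) (hpv : ((p : ℕ) : 𝓞 K) ∉ v.asIdeal)
    (σ : absoluteGaloisGroup K) :
    conjH1 κ.kerSubgroup (W.geomPrimaryTorsion p) σ c ∈
      W.localKerOver p κ.kerSubgroup (v.adicCompletion K) :=
  conjH1_mem_localKerOver_of_mem_gvSelmerInfty (κ := κ) (v := v) (W := W) (p := p) L S₀ hc hvS
    hv hpv (inertia_le_kerSubgroup_of_isCyclotomic κ v hκ hpv)
    (not_decomp_le_kerSubgroup_of_isCyclotomic κ v hκ hpv) σ

end Cyclotomic

end Summit.BirchSwinnertonDyer.Rank1Residual.X2.GreenbergVatsalUnramifiedAway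

end
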